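import Summits.Ventures.FusionMHD.Bench.SolovevPCFIterMercierProfileData1
import Summits.Ventures.FusionMHD.Bench.SolovevPCFIterMercierProfileData2
import Summits.Ventures.FusionMHD.Bench.SolovevPCFIterMercierProfileData3
import Summits.Ventures.FusionMHD.Bench.SolovevPCFIterMercierProfileData4
import Summits.Ventures.FusionMHD.Bench.SolovevPCFIterMercierProfileData5
import Summits.Ventures.FusionMHD.Bench.SolovevPCFIterMercierProfileData6
import Summits.Ventures.FusionMHD.Bench.SolovevPCFIterMercierProfileData7
import Summits.Ventures.FusionMHD.Bench.SolovevPCFIterMercierProfileData8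
import Summits.Ventures.FusionMHD.Bench.SolovevPCFIterMercierProfileData9
import Summits.Ventures.FusionMHD.Bench.SolovevPCFIterMercierProfileData10
import Summits.Ventures.FusionMHD.Bench.SolovevPCFIterMercierProfileData11
import Summits.Ventures.FusionMHD.Models.SolovevMercierProfileIdent
import Summits.Ventures.FusionMHD.Models.SolovevPCFGGJData
import HarnessLib

/-!
# F1 / MERCIER on EVERY flux surface of the ITER-like PCF Solov'ev equilibrium — the WHOLE-PROFILE certificate:
# `∀ F ≥ 13/20, ∀ 0 < r ≤ a: (ggjData F r).MercierCriterion`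
(venture LADDER-GRIDFUSION, rung F1.MERCIER-profile, row «F1.MERCIER-WHOLE-PROFILE» (#105-cand); cell `gridfusion`, seat
gridfusion-sos-6 (g6), 2026-08-27; generator `HOME/cert/sos-6/profile/emit_profile.py whole iter`.)

THE CHAIN.  gridfusion-model-7's axis-regular form (`Models/SolovevMercierAxisRegular{,Ident,IBP}`): on the surface `r` of the typed
equilibrium (`Models/SolovevPCFGGJData`: `ggjData F r = lcGGJData κ₀ F R_a (q₀F) (ε/R_a) F r`), Jardin's (8.134) criterion is
`N₀(r) < F²·N₂(r)` with `N₂, N₀` polynomials in eight loop integrals that are bounded and smooth down to the axis.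
`Models/SolovevMercierProfileIdent`: in the surface fraction `s = r/a` and after the Weierstrass substitution these are the branch sums
`T_i(s)` of the kernels of `Models/SolovevMercierProfileKernels`, and `G²N₂ − N₀ = G²·slopeT − interceptT` (T-form, rational
coefficients: `R_a² = 689 / 625`, `κ₀² = 2257675225 / 758468676`, `C_s = 1`, `k = (1 + 8d₃)R_a`).  The data files `…MercierProfileData*`
certify, box by box, the Taylor models in `s` of every `∫ ker_i dv`; HERE, per `s`-panel (`A` = `[0, 1/4]` (degree 6, 4+4 boxes) · `B` = `[1/4, 1/2]` (degree 6, 4+4 boxes) · `C` = `[1/2, 3/4]` (degree 6, 4+4 boxes) · `D` = `[3/4, 1]` (degree 5, 4+8 boxes)), the margin model built from those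
literals has positive lower range bound (`decide +kernel`, cheap), hence `G²·slopeT(s) − interceptT(s) > 0` on the panel
(`margin_pos_of_cert`), hence on all of `[0, 1]` (`margin_pos_Icc`), hence — `mercier_of_margin` + monotonicity in `F` —
**`mercier_whole_profile : 13/20 ≤ F → 0 < r → r ≤ ε/R_a → (ggjData F r).MercierCriterion`**: for every admissible `F` the necessary
local-interchange criterion (8.134) holds on EVERY flux surface of the model (sup of the certified per-surface thresholds = 0.6190279941 (axis, Bateman row p472219)
≤ 13/20).
THREE COLUMNS.  CERTIFIED = this kernel statement about MODEL M (ideal MHD, analytic fixed-boundary PCF Solov'ev equilibrium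
(ε, κ, δ) = (0.32, 1.7, 0.33) [cite: PatakiCerfonFreidberg2013, §6.1], `F = RB_φ` free).  VALIDATED (never used in a proof): gridfusion-sos-2's Arb
enclosures cert/B/f1mercier/whole-ITER-j283441 (sup g_M ≤ 0.624883, min cell margin 2.87); model-7's float table.  Mercier/GGJ is a NECESSARY criterion —
«satisfies Mercier on every surface for F ≥ 13/20» is not «stable»; nothing here is a statement about a device.
-/

open Set
open Literature.Analysis.ValidatedNumerics Literature.Analysis.ValidatedNumerics.PolyMP
open Literature.Analysis.ValidatedNumerics.NumericsMP
open Literature.MathematicalPhysics.MHD Literature.MathematicalPhysics.MHD.Solovev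
open Summit.Ventures.FusionMHD.Models Summit.Ventures.FusionMHD.Models.LcMercierProfile
open Summit.Ventures.FusionMHD.Models.SolovevPCF

namespace Summit.Ventures.FusionMHD.Bench.SolovevPCFIter.MercierProfile

set_option maxRecDepth 20000

/-- `κ₁ = k/R_a = 1 + 8d₃` (`lcAmplitude`: `κ₀F/(2R_a³q₀) = 1/2 + 4d₃`). [cite: PatakiCerfonFreidberg2013, §6.1] -/
def kap1 : ℚ := 1 + 8 * (-(189617169 / 6032287802))
/-- `G² = (13/20)²`, the certified profile bound squared. [folklore] -/
def G2 : ℚ := 169 / 400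

/-! ## §1 The panels: margin models from the certified pieces -/

/-- Panel `A`, branch `+1`: piece starts. [folklore] -/
def pA_startsP : List ℚ := [0, 1/4, 1/2, 3/4]
/-- Panel `A`, branch `+1`: piece half-widths (one box per piece). [folklore] -/
def pA_kssP : List (List ℚ) := [ [1/8], [1/8], [1/8], [1/8] ]
/-- Panel `A`, branch `+1`: the certified piece models (data files). [folklore] -/
def pA_litsP : List (List IPoly) := [ pA_P0, pA_P1, pA_P2, pA_P3 ]
/-- Panel `A`, branch `−1`: piece starts. [folklore] -/
def pA_startsM : List ℚ := [0, 1/4, 1/2, 3/4]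
/-- Panel `A`, branch `−1`: piece half-widths (one box per piece). [folklore] -/
def pA_kssM : List (List ℚ) := [ [1/8], [1/8], [1/8], [1/8] ]
/-- Panel `A`, branch `−1`: the certified piece models (data files). [folklore] -/
def pA_litsM : List (List IPoly) := [ pA_M0, pA_M1, pA_M2, pA_M3 ]

/-- KERNEL CHECK (cheap): the margin model of panel `A` from the certified pieces has positive lower range bound. [folklore] -/
theorem pA_marg :
    0 < tlowerI (2 ^ 40) (1 / 8 : ℚ) (margTM (2 ^ 40) (1 / 8 : ℚ) 8 KInst.pcfIter kap1 1 G2 (1 / 8 : ℚ)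
      (sumPieces 8 pA_litsP) (sumPieces 8 pA_litsM)) := by
  decide +kernel

/-- **Panel `A`: `G²·slopeT − interceptT > 0` for `s = 1/8 + ρ`, `|ρ| ≤ 1/8`.** [cite: Jardin2010, §8.5.4 eq. (8.134)] -/
theorem pA_pos : ∀ ρ : ℝ, |ρ| ≤ (1 / 8 : ℚ) →
    0 < ((G2 : ℚ) : ℝ) * slopeT KInst.pcfIter kap1 1 (((1 / 8 : ℚ) : ℝ) + ρ)
      - interceptT KInst.pcfIter kap1 1 (((1 / 8 : ℚ) : ℝ) + ρ) :=
  margin_pos_of_cert (S := 2 ^ 40) (P := ⟨6, 8, 12, 3, 30, 20⟩) (h := (1 / 8 : ℚ)) (cx := (1 / 8 : ℚ)) (I := KInst.pcfIter)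
    (startsP := pA_startsP) (kssP := pA_kssP) (litsP := pA_litsP)
    (startsM := pA_startsM) (kssM := pA_kssM) (litsM := pA_litsM) (D := 8) (kap1 := kap1) (cs := 1) (G2 := G2)
    (by norm_num) (by norm_num) (by decide +kernel) (by decide) (by decide +kernel) (by decide)
    (fun j hj => by
      have hj' : j < 4 := by simpa [pA_kssP] using hj
      interval_cases j <;>
        simp only [pA_startsP, pA_kssP, pA_litsP, List.getD_cons_zero, List.getD_cons_succ]
      · exact pA_P0_eq
      · exact pA_P1_eq
      · exact pA_P2_eq
      · exact pA_P3_eq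
      )
    (fun j hj => by
      have hj' : j < 4 := by simpa [pA_kssM] using hj
      interval_cases j <;>
        simp only [pA_startsM, pA_kssM, pA_litsM, List.getD_cons_zero, List.getD_cons_succ]
      · exact pA_M0_eq
      · exact pA_M1_eq
      · exact pA_M2_eq
      · exact pA_M3_eq
      )
    pA_marg

/-- Panel `B`, branch `+1`: piece starts. [folklore] -/
def pB_startsP : List ℚ := [0, 1/4, 1/2, 3/4]
/-- Panel `B`, branch `+1`: piece half-widths (one box per piece). [folklore] -/
def pB_kssP : List (List ℚ) := [ [1/8], [1/8], [1/8], [1/8] ]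
/-- Panel `B`, branch `+1`: the certified piece models (data files). [folklore] -/
def pB_litsP : List (List IPoly) := [ pB_P0, pB_P1, pB_P2, pB_P3 ]
/-- Panel `B`, branch `−1`: piece starts. [folklore] -/
def pB_startsM : List ℚ := [0, 1/4, 1/2, 3/4]
/-- Panel `B`, branch `−1`: piece half-widths (one box per piece). [folklore] -/
def pB_kssM : List (List ℚ) := [ [1/8], [1/8], [1/8], [1/8] ]
/-- Panel `B`, branch `−1`: the certified piece models (data files). [folklore] -/
def pB_litsM : List (List IPoly) := [ pB_M0, pB_M1, pB_M2, pB_M3 ]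

/-- KERNEL CHECK (cheap): the margin model of panel `B` from the certified pieces has positive lower range bound. [folklore] -/
theorem pB_marg :
    0 < tlowerI (2 ^ 40) (1 / 8 : ℚ) (margTM (2 ^ 40) (1 / 8 : ℚ) 8 KInst.pcfIter kap1 1 G2 (3 / 8 : ℚ)
      (sumPieces 8 pB_litsP) (sumPieces 8 pB_litsM)) := by
  decide +kernel

/-- **Panel `B`: `G²·slopeT − interceptT > 0` for `s = 3/8 + ρ`, `|ρ| ≤ 1/8`.** [cite: Jardin2010, §8.5.4 eq. (8.134)] -/
theorem pB_pos : ∀ ρ : ℝ, |ρ| ≤ (1 / 8 : ℚ) →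
    0 < ((G2 : ℚ) : ℝ) * slopeT KInst.pcfIter kap1 1 (((3 / 8 : ℚ) : ℝ) + ρ)
      - interceptT KInst.pcfIter kap1 1 (((3 / 8 : ℚ) : ℝ) + ρ) :=
  margin_pos_of_cert (S := 2 ^ 40) (P := ⟨6, 8, 12, 3, 30, 20⟩) (h := (1 / 8 : ℚ)) (cx := (3 / 8 : ℚ)) (I := KInst.pcfIter)
    (startsP := pB_startsP) (kssP := pB_kssP) (litsP := pB_litsP)
    (startsM := pB_startsM) (kssM := pB_kssM) (litsM := pB_litsM) (D := 8) (kap1 := kap1) (cs := 1) (G2 := G2)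
    (by norm_num) (by norm_num) (by decide +kernel) (by decide) (by decide +kernel) (by decide)
    (fun j hj => by
      have hj' : j < 4 := by simpa [pB_kssP] using hj
      interval_cases j <;>
        simp only [pB_startsP, pB_kssP, pB_litsP, List.getD_cons_zero, List.getD_cons_succ]
      · exact pB_P0_eq
      · exact pB_P1_eq
      · exact pB_P2_eq
      · exact pB_P3_eq
      )
    (fun j hj => by
      have hj' : j < 4 := by simpa [pB_kssM] using hj
      interval_cases j <;>
        simp only [pB_startsM, pB_kssM, pB_litsM, List.getD_cons_zero, List.getD_cons_succ]
      · exact pB_M0_eq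
      · exact pB_M1_eq
      · exact pB_M2_eq
      · exact pB_M3_eq
      )
    pB_marg

/-- Panel `C`, branch `+1`: piece starts. [folklore] -/
def pC_startsP : List ℚ := [0, 1/4, 1/2, 3/4]
/-- Panel `C`, branch `+1`: piece half-widths (one box per piece). [folklore] -/
def pC_kssP : List (List ℚ) := [ [1/8], [1/8], [1/8], [1/8] ]
/-- Panel `C`, branch `+1`: the certified piece models (data files). [folklore] -/
def pC_litsP : List (List IPoly) := [ pC_P0, pC_P1, pC_P2, pC_P3 ]
/-- Panel `C`, branch `−1`: piece starts. [folklore] -/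
def pC_startsM : List ℚ := [0, 1/4, 1/2, 3/4]
/-- Panel `C`, branch `−1`: piece half-widths (one box per piece). [folklore] -/
def pC_kssM : List (List ℚ) := [ [1/8], [1/8], [1/8], [1/8] ]
/-- Panel `C`, branch `−1`: the certified piece models (data files). [folklore] -/
def pC_litsM : List (List IPoly) := [ pC_M0, pC_M1, pC_M2, pC_M3 ]

/-- KERNEL CHECK (cheap): the margin model of panel `C` from the certified pieces has positive lower range bound. [folklore] -/
theorem pC_marg :
    0 < tlowerI (2 ^ 40) (1 / 8 : ℚ) (margTM (2 ^ 40) (1 / 8 : ℚ) 8 KInst.pcfIter kap1 1 G2 (5 / 8 : ℚ)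
      (sumPieces 8 pC_litsP) (sumPieces 8 pC_litsM)) := by
  decide +kernel

/-- **Panel `C`: `G²·slopeT − interceptT > 0` for `s = 5/8 + ρ`, `|ρ| ≤ 1/8`.** [cite: Jardin2010, §8.5.4 eq. (8.134)] -/
theorem pC_pos : ∀ ρ : ℝ, |ρ| ≤ (1 / 8 : ℚ) →
    0 < ((G2 : ℚ) : ℝ) * slopeT KInst.pcfIter kap1 1 (((5 / 8 : ℚ) : ℝ) + ρ)
      - interceptT KInst.pcfIter kap1 1 (((5 / 8 : ℚ) : ℝ) + ρ) :=
  margin_pos_of_cert (S := 2 ^ 40) (P := ⟨6, 8, 12, 3, 30, 20⟩) (h := (1 / 8 : ℚ)) (cx := (5 / 8 : ℚ)) (I := KInst.pcfIter)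
    (startsP := pC_startsP) (kssP := pC_kssP) (litsP := pC_litsP)
    (startsM := pC_startsM) (kssM := pC_kssM) (litsM := pC_litsM) (D := 8) (kap1 := kap1) (cs := 1) (G2 := G2)
    (by norm_num) (by norm_num) (by decide +kernel) (by decide) (by decide +kernel) (by decide)
    (fun j hj => by
      have hj' : j < 4 := by simpa [pC_kssP] using hj
      interval_cases j <;>
        simp only [pC_startsP, pC_kssP, pC_litsP, List.getD_cons_zero, List.getD_cons_succ]
      · exact pC_P0_eq
      · exact pC_P1_eq
      · exact pC_P2_eq
      · exact pC_P3_eq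
      )
    (fun j hj => by
      have hj' : j < 4 := by simpa [pC_kssM] using hj
      interval_cases j <;>
        simp only [pC_startsM, pC_kssM, pC_litsM, List.getD_cons_zero, List.getD_cons_succ]
      · exact pC_M0_eq
      · exact pC_M1_eq
      · exact pC_M2_eq
      · exact pC_M3_eq
      )
    pC_marg

/-- Panel `D`, branch `+1`: piece starts. [folklore] -/
def pD_startsP : List ℚ := [0, 1/4, 1/2, 3/4]
/-- Panel `D`, branch `+1`: piece half-widths (one box per piece). [folklore] -/
def pD_kssP : List (List ℚ) := [ [1/8], [1/8], [1/8], [1/8] ]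
/-- Panel `D`, branch `+1`: the certified piece models (data files). [folklore] -/
def pD_litsP : List (List IPoly) := [ pD_P0, pD_P1, pD_P2, pD_P3 ]
/-- Panel `D`, branch `−1`: piece starts. [folklore] -/
def pD_startsM : List ℚ := [0, 1/8, 1/4, 3/8, 1/2, 5/8, 3/4, 7/8]
/-- Panel `D`, branch `−1`: piece half-widths (one box per piece). [folklore] -/
def pD_kssM : List (List ℚ) := [ [1/16], [1/16], [1/16], [1/16], [1/16], [1/16], [1/16], [1/16] ]
/-- Panel `D`, branch `−1`: the certified piece models (data files). [folklore] -/
def pD_litsM : List (List IPoly) := [ pD_M0, pD_M1, pD_M2, pD_M3, pD_M4, pD_M5, pD_M6, pD_M7 ]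

/-- KERNEL CHECK (cheap): the margin model of panel `D` from the certified pieces has positive lower range bound. [folklore] -/
theorem pD_marg :
    0 < tlowerI (2 ^ 40) (1 / 8 : ℚ) (margTM (2 ^ 40) (1 / 8 : ℚ) 8 KInst.pcfIter kap1 1 G2 (7 / 8 : ℚ)
      (sumPieces 8 pD_litsP) (sumPieces 8 pD_litsM)) := by
  decide +kernel

/-- **Panel `D`: `G²·slopeT − interceptT > 0` for `s = 7/8 + ρ`, `|ρ| ≤ 1/8`.** [cite: Jardin2010, §8.5.4 eq. (8.134)] -/
theorem pD_pos : ∀ ρ : ℝ, |ρ| ≤ (1 / 8 : ℚ) →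
    0 < ((G2 : ℚ) : ℝ) * slopeT KInst.pcfIter kap1 1 (((7 / 8 : ℚ) : ℝ) + ρ)
      - interceptT KInst.pcfIter kap1 1 (((7 / 8 : ℚ) : ℝ) + ρ) :=
  margin_pos_of_cert (S := 2 ^ 40) (P := ⟨5, 7, 12, 3, 30, 20⟩) (h := (1 / 8 : ℚ)) (cx := (7 / 8 : ℚ)) (I := KInst.pcfIter)
    (startsP := pD_startsP) (kssP := pD_kssP) (litsP := pD_litsP)
    (startsM := pD_startsM) (kssM := pD_kssM) (litsM := pD_litsM) (D := 8) (kap1 := kap1) (cs := 1) (G2 := G2)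
    (by norm_num) (by norm_num) (by decide +kernel) (by decide) (by decide +kernel) (by decide)
    (fun j hj => by
      have hj' : j < 4 := by simpa [pD_kssP] using hj
      interval_cases j <;>
        simp only [pD_startsP, pD_kssP, pD_litsP, List.getD_cons_zero, List.getD_cons_succ]
      · exact pD_P0_eq
      · exact pD_P1_eq
      · exact pD_P2_eq
      · exact pD_P3_eq
      )
    (fun j hj => by
      have hj' : j < 8 := by simpa [pD_kssM] using hj
      interval_cases j <;>
        simp only [pD_startsM, pD_kssM, pD_litsM, List.getD_cons_zero, List.getD_cons_succ]
      · exact pD_M0_eq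
      · exact pD_M1_eq
      · exact pD_M2_eq
      · exact pD_M3_eq
      · exact pD_M4_eq
      · exact pD_M5_eq
      · exact pD_M6_eq
      · exact pD_M7_eq
      )
    pD_marg

/-! ## §2 The whole unit interval of surface fractions -/

/-- **`G²·slopeT(s) − interceptT(s) > 0` for every `s ∈ [0, 1]`** (the panels cover `[0, 1]`). [cite: Jardin2010, §8.5.4 eq. (8.134)] -/
theorem margin_pos_Icc {s : ℝ} (hs0 : 0 ≤ s) (hs1 : s ≤ 1) :
    0 < ((G2 : ℚ) : ℝ) * slopeT KInst.pcfIter kap1 1 s - interceptT KInst.pcfIter kap1 1 s := by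
  rcases le_or_gt s (1 / 4 : ℝ) with h0 | h0
  · have := pA_pos (s - (1 / 8 : ℝ)) (by rw [abs_le]; push_cast; constructor <;> linarith)
    have e : (((1 / 8 : ℚ) : ℝ) + (s - (1 / 8 : ℝ))) = s := by push_cast; ring
    rwa [e] at this
  rcases le_or_gt s (1 / 2 : ℝ) with h1 | h1
  · have := pB_pos (s - (3 / 8 : ℝ)) (by rw [abs_le]; push_cast; constructor <;> linarith)
    have e : (((3 / 8 : ℚ) : ℝ) + (s - (3 / 8 : ℝ))) = s := by push_cast; ring
    rwa [e] at this
  rcases le_or_gt s (3 / 4 : ℝ) with h2 | h2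
  · have := pC_pos (s - (5 / 8 : ℝ)) (by rw [abs_le]; push_cast; constructor <;> linarith)
    have e : (((5 / 8 : ℚ) : ℝ) + (s - (5 / 8 : ℝ))) = s := by push_cast; ring
    rwa [e] at this
  have := pD_pos (s - (7 / 8 : ℝ)) (by rw [abs_le]; push_cast; constructor <;> linarith)
  have e : (((7 / 8 : ℚ) : ℝ) + (s - (7 / 8 : ℝ))) = s := by push_cast; ring
  rwa [e] at this

/-! ## §3 The criterion on every flux surface of the typed equilibrium -/

/-- The instance dictionary: `R_a² = u0`, `ε = a·R_a` (`a = ε/R_a`), `1/κ₀²`, `κ₀F/(R_a²q₀) = κ₁R_a`, `C_s = 1`. [cite: PatakiCerfonFreidberg2013, §6.1] -/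
theorem instance_dict {F : ℝ} (hF : 0 < F) :
    ((KInst.pcfIter.u0 : ℚ) : ℝ) = IterLike.Ra ^ 2
    ∧ ((KInst.pcfIter.eps : ℚ) : ℝ) = (IterLike.ε / IterLike.Ra) * IterLike.Ra
    ∧ ((KInst.pcfIter.invKsq : ℚ) : ℝ) = (IterLike.kappa0 ^ 2)⁻¹
    ∧ IterLike.kappa0 * F / (IterLike.Ra ^ 2 * IterLike.q0 F) = (kap1 : ℝ) * IterLike.Ra
    ∧ csLC IterLike.kappa0 F IterLike.Ra (IterLike.q0 F) = ((1 : ℚ) : ℝ) := by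
  have hRa := IterLike.Ra_pos
  have hRa2 := IterLike.Ra_sq
  have hk2 := IterLike.kappa0_sq
  have hA := IterLike.lcAmplitude hF.ne'
  have hq := IterLike.q0_pos hF
  have hk := IterLike.kappa0_pos
  refine ⟨?_, ?_, ?_, ?_, ?_⟩
  · rw [hRa2]; norm_num [KInst.pcfIter]
  · rw [div_mul_cancel₀ _ hRa.ne']; norm_num [KInst.pcfIter, IterLike.ε]
  · rw [hk2]; norm_num [KInst.pcfIter, IterLike.elongSq]
  · have e : IterLike.kappa0 * F / (IterLike.Ra ^ 2 * IterLike.q0 F)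
        = 2 * IterLike.Ra * (IterLike.kappa0 * F / (2 * IterLike.Ra ^ 3 * IterLike.q0 F)) := by
      field_simp
    rw [e, hA]; simp only [kap1, IterLike.d₃]; push_cast; ring
  · rw [IterLike.csLC_eq_one hF]; norm_num

/-- **MERCIER ON EVERY FLUX SURFACE, `F ≥ 13/20`.**  For every value `F ≥ 13/20` of the free constant `RB_φ` and every flux
surface `0 < r ≤ a = ε/R_a` of the ITER-like PCF Solov'ev equilibrium, Jardin's flux-coordinate Mercier criterion (8.134) holds on
gridfusion-model-5's typed surface record `ggjData F r` (the tree's functionals of the typed `Ψ`).  MODELLED: ideal MHD, analytic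
fixed-boundary equilibrium; a NECESSARY local-interchange criterion — never «stable», never a device.
[cite: Jardin2010, §8.5.4 eq. (8.134)] -/
theorem mercier_whole_profile {F r : ℝ} (hF : (13 / 20 : ℝ) ≤ F) (hr : 0 < r) (hre : r ≤ IterLike.ε / IterLike.Ra) :
    (IterLike.ggjData F r).MercierCriterion := by
  have hF0 : 0 < F := lt_of_lt_of_le (by norm_num) hF
  obtain ⟨ha, h2a⟩ := IterLike.edge_minorRadius
  obtain ⟨hu0, he, hk, hkap, hcs⟩ := instance_dict hF0
  set a := IterLike.ε / IterLike.Ra with ha_def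
  have hs0 : 0 < r / a := div_pos hr ha
  have hs1 : r / a ≤ 1 := (div_le_one ha).2 hre
  have hra : r = r / a * a := by field_simp
  have hsa : 2 * (r / a * a) < IterLike.Ra := by rw [← hra]; linarith
  have hm := margin_pos_Icc hs0.le hs1
  have hm' : 0 < ((((13 / 20 : ℚ) ^ 2 : ℚ)) : ℝ) * slopeT KInst.pcfIter kap1 1 (r / a) - interceptT KInst.pcfIter kap1 1 (r / a) := by
    have e : ((((13 / 20 : ℚ) ^ 2 : ℚ)) : ℝ) = ((G2 : ℚ) : ℝ) := by norm_num [G2]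
    rw [e]; exact hm
  unfold IterLike.ggjData
  rw [hra]
  exact mercier_of_margin KInst.pcfIter (hR₀ := IterLike.Ra_pos) (hκ := IterLike.kappa0_pos) (hFB := hF0) (hq₀ := IterLike.q0_pos hF0)
    (hu0 := hu0) (he := he) (hk := hk) (hkap := hkap) (hcs := hcs) (hs0 := hs0.le) (hsa := hsa) (ha := ha.le)
    hs0 ha (G := (13 / 20 : ℚ)) (by norm_num) (by push_cast; linarith) hm' _

end Summit.Ventures.FusionMHD.Bench.SolovevPCFIter.MercierProfile
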